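import Summits.CriticalPhenomena.PercolationContinuityZ3.Theorems.PercNearOneGluingNoHeavyQuantLowCapacity
import Summits.CriticalPhenomena.PercolationContinuityZ3.Theorems.PercNearOneGluingNoHeavyQuantSliceTwoRowRates
import HarnessLib

/-!
# QUANT lane R8, T-DEC: the GIANT BUDGET of the single-low blueprint, Case 1 — the `g`-mixture of the two capacity inequalities
# (LEAD-NOTES-G22 N48 (3))

builds on p205010 (kernel theorem, internal audit signed; external expert review pending)

Support file (`--supports stmt-CriticalPhenomena-4575`), QUANT lane typer seat prim-quant-stmt (gen 23), rung R8 of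
`run/shared/lean/prim/quant/LADDER.md`.  Theorems only; standard axioms, no sorries.  Uses lead g22's `…QuantLowCapacity` (p305864:
`capCoef`, the capacity inequalities (H_j′) `low_capacity_of_decAtT` and (H_λ*) `low_giantCapacity_of_decAtT`) and `…QuantSliceTwoRowRates`
(p305242: `pairGate_antiDiag_le`, `deep_straddler_two_mul_gt`, `antiDiag_compatible`).  It is the ARITHMETIC CORE of Case 1 of the single-low
blueprint for SL-λ* (N48 (3)); the flow bookkeeping of the routing R* (band verticals, anti-diagonals, giant split) is left to
`…QuantSliceSingleLow`.

Setting: law `ν ≥ 0` on `{0..M}`, target `T`, floor `0 < x < 1`, layer `j′`, blob `(a, g)` with `0 ≤ g ≤ 1`, raised target `T′ = T + a·g`;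
`l` a DEEP low (`2l < T`, `2(l+a) < T′`).  For a compatible mid `h ≤ j′` (`T ≤ 2h`, `T < l + h`) write `u⁰_h = usage x T j′ l h` and
`u_ad(h) = usage x T′ j′ (l+a) h` (the anti-diagonal pair of the slice), `A_h = (1−g)·ν h / u_ad(h)` (the row-1 mass that saturates the row-0
copy of `h`).
* **`usage_antiDiag_le`** — `u_ad(h) ≤ u⁰_h` (lead's `pairGate_antiDiag_le` through `t ↦ t/(1−t)`).
* **`singleLow_giant_budget`** — from (H_j′) `(x/(1−x))·ν l ≤ Σ_h capCoef(h)·ν h` and (H_λ) `(x/(1−x))·ν l ≤ Σ_{λ < h ≤ M} ν h`: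
  `(x/(1−x))·(ν l − Σ_{compatible mids h ≤ j′} A_h) ≤ (1−g)·Σ_{j′ < h ≤ M} ν h + g·Σ_{λ < h ≤ M} ν h`
  — the `g`-MIXTURE `g·(H_λ) + (1−g)·(H_j′)` plus `u_ad ≤ u⁰` termwise: in Case 1 of N48 (3) (`Σ A_h ≤ g·ν l`: the row-1 copy `l + a`
  saturates every row-0 window mid) the left side is `x/(1−x)` times the mass of the two copies of `l` that must ride the slice's giants,
  and the right side is the mass of the giant parts they may use (row-0 giants `(1−g)ν h`, `h > j′`; row-1 copies `g·ν h` of the atoms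
  above `λ`, all giants when `λ ≥ j′ − a`).  Holds for every `λ`; the blueprint takes `λ = λ*`.

[this work]; `…QuantLawDecFlows` (typer g22), `…QuantFlowUncross` (this seat), `…QuantLowCapacity/SliceTwoRowRates` (lead g22).  Nothing here
is cited as a published result.  The gluing rows served [cite: KozmaNitzan2024, Conjecture 3 (p. 15)]; product measure
[cite: Grimmett1999, §1.3 p. 10].
-/

noncomputable section

namespace Summit.CriticalPhenomena.PercolationContinuityZ3.Theorems

namespace Quant

open Finset

namespace LawDec

/-- **the anti-diagonal pair has smaller usage**: for a deep low `l` (`2l < T`, `2(l+a) < T + ag`), a compatible mid `h ≤ j′`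
(`T < l + h`), `0 < x < 1`, `g ≤ 1`: `usage x (T + ag) j′ (l+a) h ≤ usage x T j′ l h`. [this work] -/
theorem usage_antiDiag_le (x T g : ℝ) (j' l h a : ℕ) (hx0 : 0 < x) (hx1 : x < 1) (hg1 : g ≤ 1) (hhj : h ≤ j')
    (hlow : 2 * (l : ℝ) < T) (hdeep : 2 * ((l : ℝ) + a) < T + (a : ℝ) * g) (hcomp : T < (l : ℝ) + h) :
    usage x (T + (a : ℝ) * g) j' (l + a) h ≤ usage x T j' l h := by
  have hnj : ¬ (j' + 1 ≤ h) := by omega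
  have hmid := deep_straddler_two_mul_gt T g l h a hg1 hdeep hcomp
  have hlam : l + a < h := deep_lt_mid T g l h a hdeep hmid.le
  have hpq := pairGate_antiDiag_le x T g l h a hx1.le hg1 hcomp hlam
  have hq := pairGate_lt_one x T l h hx0 hx1 hlow hcomp
  simp only [usage, gateOf, if_neg hnj]
  rw [div_le_div_iff₀ (by linarith) (by linarith)]
  nlinarith

/-- giants among `0..M` as an indicator sum. -/
theorem sum_range_ite_gt_eq_Ico (j' M : ℕ) (φ : ℕ → ℝ) :
    ∑ h ∈ Finset.range (M + 1), (if j' + 1 ≤ h then φ h else 0) = ∑ h ∈ Finset.Ico (j' + 1) (M + 1), φ h := by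
  rw [← Finset.sum_filter]
  congr 1
  ext h
  simp only [Finset.mem_filter, Finset.mem_range, Finset.mem_Ico]
  omega

/-- **THE GIANT BUDGET OF CASE 1 (the `g`-mixture).**  See the file header. [this work] -/
theorem singleLow_giant_budget (x T g : ℝ) (j' M l a lam : ℕ) (ν : ℕ → ℝ) (hx0 : 0 < x) (hx1 : x < 1) (hg0 : 0 ≤ g) (hg1 : g ≤ 1)
    (hν : ∀ k, 0 ≤ ν k) (hlow : 2 * (l : ℝ) < T) (hdeep : 2 * ((l : ℝ) + a) < T + (a : ℝ) * g)
    (hCj : x / (1 - x) * ν l ≤ ∑ h ∈ Finset.range (M + 1), capCoef x T j' l h * ν h)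
    (hClam : x / (1 - x) * ν l ≤ ∑ h ∈ Finset.Ico (lam + 1) (M + 1), ν h) :
    x / (1 - x) * (ν l - ∑ h ∈ Finset.range (M + 1),
        (if h ≤ j' ∧ T ≤ 2 * (h : ℝ) ∧ T < (l : ℝ) + h then (1 - g) * ν h / usage x (T + (a : ℝ) * g) j' (l + a) h else 0))
      ≤ (1 - g) * ∑ h ∈ Finset.Ico (j' + 1) (M + 1), ν h + g * ∑ h ∈ Finset.Ico (lam + 1) (M + 1), ν h := by
  have h1x : 0 < 1 - x := by linarith
  have hxr : 0 < x / (1 - x) := div_pos hx0 h1x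
  have h1g : 0 ≤ 1 - g := by linarith
  -- termwise: (1−g)·capCoef(h)·ν h ≤ (1−g)·[giant]·ν h + (x/(1−x))·A_h
  have key : ∀ h ∈ Finset.range (M + 1), (1 - g) * (capCoef x T j' l h * ν h)
      ≤ (1 - g) * (if j' + 1 ≤ h then ν h else 0) + x / (1 - x) *
        (if h ≤ j' ∧ T ≤ 2 * (h : ℝ) ∧ T < (l : ℝ) + h then (1 - g) * ν h / usage x (T + (a : ℝ) * g) j' (l + a) h else 0) := by
    intro h _
    unfold capCoef
    by_cases hgi : j' + 1 ≤ h
    · rw [if_pos hgi, if_pos hgi, if_neg (by omega)]; linarith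
    · rw [if_neg hgi, if_neg hgi]
      have hhj : h ≤ j' := by omega
      by_cases hc : T ≤ 2 * (h : ℝ) ∧ T < (l : ℝ) + h
      · rw [if_pos hc, if_pos ⟨hhj, hc⟩]
        have hmid := deep_straddler_two_mul_gt T g l h a hg1 hdeep hc.2
        have hlam' : l + a < h := deep_lt_mid T g l h a hdeep hmid.le
        have hcomp' := antiDiag_compatible T g l h a hg1 hc.2
        have hlow' : 2 * (((l + a : ℕ) : ℝ)) < T + (a : ℝ) * g := by push_cast; exact hdeep
        have huad : 0 < usage x (T + (a : ℝ) * g) j' (l + a) h :=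
          usage_pos_of_compat x (T + (a : ℝ) * g) j' (l + a) h hx0 hx1 hlow' hlam' (Or.inr hcomp')
        have hle := usage_antiDiag_le x T g j' l h a hx0 hx1 hg1 hhj hlow hdeep hc.2
        -- (1−g)·(x/(1−x))/u⁰·ν ≤ (x/(1−x))·(1−g)·ν/u_ad  since  u_ad ≤ u⁰
        have hinv : 1 / usage x T j' l h ≤ 1 / usage x (T + (a : ℝ) * g) j' (l + a) h :=
          one_div_le_one_div_of_le huad hle
        have hνh := hν h
        have hc1 : x / (1 - x) / usage x T j' l h * ν h = (x / (1 - x) * ν h) * (1 / usage x T j' l h) := by ring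
        have hc2 : x / (1 - x) * ((1 - g) * ν h / usage x (T + (a : ℝ) * g) j' (l + a) h)
            = (1 - g) * ((x / (1 - x) * ν h) * (1 / usage x (T + (a : ℝ) * g) j' (l + a) h)) := by ring
        rw [hc1, hc2, mul_zero, zero_add]
        exact mul_le_mul_of_nonneg_left (mul_le_mul_of_nonneg_left hinv (mul_nonneg hxr.le hνh)) h1g
      · rw [if_neg hc, if_neg (fun h' => hc h'.2)]; simp
  have hsum := Finset.sum_le_sum key
  rw [← Finset.mul_sum, Finset.sum_add_distrib, ← Finset.mul_sum, ← Finset.mul_sum, sum_range_ite_gt_eq_Ico j' M ν] at hsum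
  -- the g-mixture
  have hmix : x / (1 - x) * ν l = g * (x / (1 - x) * ν l) + (1 - g) * (x / (1 - x) * ν l) := by ring
  have h1 := mul_le_mul_of_nonneg_left hClam hg0
  have h2 := mul_le_mul_of_nonneg_left hCj h1g
  rw [mul_sub]
  linarith

end LawDec

end Quant

end Summit.CriticalPhenomena.PercolationContinuityZ3.Theorems
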